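import Literature.Analysis.FluidPDE.PassiveVectorTensorDistorted
import Literature.Analysis.FunctionSpaces.TorusCalculusProofs
import Summits.AnomalousDissipation.AnomalousDissipation.Theorems.SolenoidalFractalHomogenisationLagrangianCarrierPushforward
import Summits.AnomalousDissipation.AnomalousDissipation.Theorems.SolenoidalFractalHomogenisationLagrangianStepFrameModulationInputs

/-!
# K1L_D (stmt-AnomalousDissipation-27980), `stub_Z7_alphaBeta` (α) / memo L15 (T1) item **(C2)**: the VISCOUS CONJUGATION IDENTITY
# `viscAdjVar (𝔸^{G}) (Φ ∘ X) = (viscAdj 𝔸 Φ) ∘ X` (helper, `--supports 27980 --as helper`; prover ad-k1loc-p3 g8, TAKES «T1» (C2))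

Pure torus calculus, no PDE (lead-k1l-onelevel-p1 g5's memo L15 §1 (iv)).  For a smooth displacement `u` of `𝕋ᵈ`, the self-map
`X y = y + proj (u y)` with Jacobian matrix `J(y)_{ac} = ((id + Du(y)) e_c)_a`, a smooth matrix field `G` with `J·G = 1` and
divergence-free columns (Piola, `Σ_e ∂_e G_{eb} = 0`), a constant tensor `𝔸` and a smooth vector field `Φ`:
* `partialDeriv_comp_displacement` — the chain rule in coordinates `∂_c (θ ∘ X) = Σ_a J_{ac} · (∂_a θ) ∘ X`;
* `sum_mul_partialDeriv_comp_displacement` — contraction with `G`: `Σ_c G_{ca} ∂_c (θ ∘ X) = (∂_a θ) ∘ X` (`J·G = 1`);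
* **`viscAdjVar_conj_comp_displacement`** — `viscAdjVar (fun y => Visc4.conj (G y) 𝔸) (Φ ∘ X) y = viscAdj 𝔸 Φ (X y)`: expand
  `𝔸^G_{icle} = Σ_{a,b} G_{ca} 𝔸_{ialb} G_{eb}`, contract `c` (previous item), Leibniz in `e`, Piola kills `Σ_e ∂_e G_{eb}`, contract `e`
  again, and exchange the two derivatives of `Φ` — no second derivative of `X` survives (divergence form + Piola);
* **`viscAdjVar_conj_frameG`** — the instance for the Lagrangian frame of a level-regular carrier on a refresh window:
  `G = frameG E m (jR+u) (jR)` (`J·G = 1` from `det_frameJac_eq_one`, smooth entries `isSmooth_frameG_entry`, Piola `isDivFree_frameG_col`),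
  `X = E.X m (jR+u) (jR)`.
This is the viscous term of the frame ⇒ Eulerian transfer (T1); NOT (T1) itself, not `stub_Z7_alphaBeta`, not K1L_D, not AD; rung F-D1.A0.
-/

set_option linter.dupNamespace false

noncomputable section

namespace Summit.AnomalousDissipation.AnomalousDissipation.Theorems.SolenoidalFractalHomogenisation.LagrangianStep.FrameForm

open Set Function MeasureTheory
open Literature.Analysis Literature.Analysis.FunctionSpaces Literature.Analysis.FunctionSpaces.Torus
open Literature.Analysis.FluidPDE Literature.Analysis.FluidPDE.LatticeShear
open Summit.AnomalousDissipation.AnomalousDissipation.Theorems.SolenoidalFractalHomogenisation.LagrangianCarrier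

/-! ## §1 Displacement maps of `𝕋ᵈ`: chain rule in coordinates, contraction with the inverse Jacobian, the identity -/

section Displacement

variable {d : Type*} [Fintype d] [DecidableEq d]

/-- Expansion of a vector on the standard basis. [folklore] -/
private theorem eq_sum_smul_single (w : EuclideanSpace ℝ d) : w = ∑ a, w a • EuclideanSpace.single a (1 : ℝ) := by
  ext i
  simp only [WithLp.ofLp_sum, WithLp.ofLp_smul, Finset.sum_apply, Pi.smul_apply, smul_eq_mul, PiLp.ofLp_single]
  rw [Finset.sum_eq_single i (fun b _ hb => by simp [Ne.symm hb]) (by simp)]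
  simp

/-- `∂_e (c · f) = c · ∂_e f` for a `C¹` scalar function. [folklore] -/
private theorem partialDeriv_const_mul' {f : UnitAddTorus d → ℝ} (hf : IsContDiff 1 f) (c : ℝ) (e : d) (y : UnitAddTorus d) :
    partialDeriv e (fun y' => c * f y') y = c * partialDeriv e f y := by
  have e1 : (fun y' => c * f y') = c • f := rfl
  rw [e1, partialDeriv_const_smul hf, Pi.smul_apply, smul_eq_mul]

/-- **Chain rule in coordinates for a displacement map** `X y = y + proj (u y)`:
`∂_c (θ ∘ X)(y) = Σ_a ((id + Du(y)) e_c)_a • (∂_a θ)(X y)`. [folklore] -/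
theorem partialDeriv_comp_displacement {F : Type*} [NormedAddCommGroup F] [NormedSpace ℝ F] {θ : UnitAddTorus d → F}
    (hθ : IsSmooth θ) {u : UnitAddTorus d → EuclideanSpace ℝ d} (hu : IsSmooth u) (c : d) (y : UnitAddTorus d) :
    partialDeriv c (fun x => θ (x + proj (u x))) y =
      ∑ a, ((ContinuousLinearMap.id ℝ (EuclideanSpace ℝ d) + Torus.fderiv u y) (EuclideanSpace.single c 1)) a •
        partialDeriv a θ (y + proj (u y)) := by
  have hS : IsSmooth (fun x => θ (x + proj (u x))) := isSmooth_comp_displacement hθ hu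
  rw [partialDeriv_eq_fderiv_apply (hS.isContDiff (by simp)), fderiv_comp_displacement hθ hu y,
    ContinuousLinearMap.comp_apply]
  conv_lhs => rw [eq_sum_smul_single ((ContinuousLinearMap.id ℝ (EuclideanSpace ℝ d) + Torus.fderiv u y)
    (EuclideanSpace.single c 1)), map_sum]
  refine Finset.sum_congr rfl fun a _ => ?_
  rw [map_smul, partialDeriv_eq_fderiv_apply (hθ.isContDiff (by simp))]

/-- **Contraction with a right inverse of the Jacobian**: if `Σ_c J(y)_{a'c} G(y)_{ca} = δ_{a'a}` then
`Σ_c G(y)_{ca} ∂_c (θ ∘ X)(y) = (∂_a θ)(X y)` for every smooth scalar `θ`. [folklore] -/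
theorem sum_mul_partialDeriv_comp_displacement {θ : UnitAddTorus d → ℝ} (hθ : IsSmooth θ)
    {u : UnitAddTorus d → EuclideanSpace ℝ d} (hu : IsSmooth u) {G : UnitAddTorus d → Matrix d d ℝ} {y : UnitAddTorus d}
    (hJG : ∀ a a' : d, ∑ c, ((ContinuousLinearMap.id ℝ (EuclideanSpace ℝ d) + Torus.fderiv u y) (EuclideanSpace.single c 1)) a'
      * G y c a = if a' = a then 1 else 0) (a : d) :
    ∑ c, G y c a * partialDeriv c (fun x => θ (x + proj (u x))) y = partialDeriv a θ (y + proj (u y)) := by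
  simp_rw [partialDeriv_comp_displacement hθ hu, smul_eq_mul, Finset.mul_sum]
  rw [Finset.sum_comm]
  have h : ∀ a' : d, ∑ c, G y c a * (((ContinuousLinearMap.id ℝ (EuclideanSpace ℝ d) + Torus.fderiv u y)
      (EuclideanSpace.single c 1)) a' * partialDeriv a' θ (y + proj (u y)))
      = (if a' = a then 1 else 0) * partialDeriv a' θ (y + proj (u y)) := fun a' => by
    rw [← hJG a a', Finset.sum_mul]
    exact Finset.sum_congr rfl fun c _ => by ring
  simp_rw [h]
  simp only [ite_mul, one_mul, zero_mul, Finset.sum_ite_eq', Finset.mem_univ, if_true]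

/-- Mixed second derivatives, coordinate form: `(∂_a ∂_b Φ)(x)_i = ∂_b ∂_a (Φ_i)(x)` for smooth `Φ`. [folklore] -/
private theorem partialDeriv_partialDeriv_apply {Φ : UnitAddTorus d → EuclideanSpace ℝ d} (hΦ : IsSmooth Φ) (a b : d)
    (x : UnitAddTorus d) (i : d) :
    (partialDeriv a (partialDeriv b Φ) x) i = partialDeriv b (partialDeriv a (fun x => Φ x i)) x := by
  rw [partialDeriv_comm hΦ a b x, ← partialDeriv_apply_coord ((hΦ.partialDeriv a).isContDiff (by simp)) b x i]
  exact congrArg (fun F => partialDeriv b F x) (funext fun y => (partialDeriv_apply_coord (hΦ.isContDiff (by simp)) a y i).symm)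

/-- **THE VISCOUS CONJUGATION IDENTITY for a displacement map.**  `u` smooth, `X y = y + proj (u y)`, `G` a smooth matrix field with
`J·G = 1` (`J(y)_{ac} = ((id + Du(y)) e_c)_a`) and divergence-free columns (Piola `Σ_e ∂_e G_{eb} = 0`); then for every constant tensor
`𝔸` and smooth `Φ`: `viscAdjVar (fun y => 𝔸^{G(y)}) (Φ ∘ X) y = (viscAdj 𝔸 Φ)(X y)`.
(Giaquinta 1983, Ch. III §2 (2.1)–(2.3): divergence-form systems under a change of variables.) [folklore] -/
theorem viscAdjVar_conj_comp_displacement (𝔸 : FluidPDE.Torus.Visc4 d) {Φ : UnitAddTorus d → EuclideanSpace ℝ d} (hΦ : IsSmooth Φ)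
    {u : UnitAddTorus d → EuclideanSpace ℝ d} (hu : IsSmooth u) {G : UnitAddTorus d → Matrix d d ℝ}
    (hG : ∀ e b, IsSmooth (fun y => G y e b))
    (hJG : ∀ (y : UnitAddTorus d) (a a' : d), ∑ c, ((ContinuousLinearMap.id ℝ (EuclideanSpace ℝ d) + Torus.fderiv u y)
      (EuclideanSpace.single c 1)) a' * G y c a = if a' = a then 1 else 0)
    (hPiola : ∀ (b : d) (y : UnitAddTorus d), ∑ e, partialDeriv e (fun y' => G y' e b) y = 0) (y : UnitAddTorus d) :
    FluidPDE.Torus.viscAdjVar (fun y' => FluidPDE.Torus.Visc4.conj (G y') 𝔸) (fun x => Φ (x + proj (u x))) y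
      = FluidPDE.Torus.viscAdj 𝔸 Φ (y + proj (u y)) := by
  -- smoothness bookkeeping
  have hS : IsSmooth (fun x => Φ (x + proj (u x))) := isSmooth_comp_displacement hΦ hu
  have hSi : ∀ c i, IsSmooth (fun y' => (partialDeriv c (fun x => Φ (x + proj (u x))) y') i) :=
    fun c i => (hS.partialDeriv c).apply i
  have hΦi : ∀ i, IsSmooth (fun x => Φ x i) := fun i => hΦ.apply i
  have hψS : ∀ i a, IsSmooth (fun y' => partialDeriv a (fun x => Φ x i) (y' + proj (u y'))) :=
    fun i a => isSmooth_comp_displacement ((hΦi i).partialDeriv a) hu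
  have hconj : ∀ i c l e, IsSmooth (fun y' => FluidPDE.Torus.Visc4.conj (G y') 𝔸 i c l e) := fun i c l e => by
    show IsSmooth (fun y' => ∑ a, ∑ b, G y' c a * 𝔸 i a l b * G y' e b)
    exact ContDiff.sum fun a _ => ContDiff.sum fun b _ => ((hG c a).mul contDiff_const).mul (hG e b)
  have hh : ∀ i a b e, IsSmooth (fun y' => G y' e b * partialDeriv a (fun x => Φ x i) (y' + proj (u y'))) :=
    fun i a b e => ContDiff.mul (hG e b) (hψS i a)
  have hg : ∀ i c l e, IsSmooth (fun y' => FluidPDE.Torus.Visc4.conj (G y') 𝔸 i c l e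
      * (partialDeriv c (fun x => Φ (x + proj (u x))) y') i) := fun i c l e => ContDiff.mul (hconj i c l e) (hSi c i)
  have hAh : ∀ i a l b e, IsSmooth (fun y' => 𝔸 i a l b * (G y' e b * partialDeriv a (fun x => Φ x i) (y' + proj (u y')))) :=
    fun i a l b e => ContDiff.mul contDiff_const (hh i a b e)
  ext l
  rw [FluidPDE.Torus.viscAdjVar_apply, FluidPDE.Torus.viscAdj_apply]
  refine Finset.sum_congr rfl fun i _ => ?_
  -- the contraction in `c`, as a function identity (for each `e`)
  have hinner : ∀ e, (fun y' => ∑ c, FluidPDE.Torus.Visc4.conj (G y') 𝔸 i c l e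
        * (partialDeriv c (fun x => Φ (x + proj (u x))) y') i)
      = fun y' => ∑ a, ∑ b, 𝔸 i a l b * (G y' e b * partialDeriv a (fun x => Φ x i) (y' + proj (u y'))) := by
    intro e
    funext y'
    have hc : ∀ c, (partialDeriv c (fun x => Φ (x + proj (u x))) y') i = partialDeriv c (fun x => Φ (x + proj (u x)) i) y' :=
      fun c => (partialDeriv_apply_coord (hS.isContDiff (by simp)) c y' i).symm
    simp_rw [hc, FluidPDE.Torus.Visc4.conj_apply, Finset.sum_mul]
    rw [Finset.sum_comm]
    refine Finset.sum_congr rfl fun a _ => ?_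
    rw [Finset.sum_comm]
    refine Finset.sum_congr rfl fun b _ => ?_
    rw [← sum_mul_partialDeriv_comp_displacement (hΦi i) hu (hJG y') a, Finset.mul_sum, Finset.mul_sum]
    exact Finset.sum_congr rfl fun c _ => by ring
  -- the `e`-sum of derivatives of `h_{abe}`: Leibniz, Piola, contraction in `e`
  have hkey : ∀ a b, ∑ e, partialDeriv e (fun y' => G y' e b * partialDeriv a (fun x => Φ x i) (y' + proj (u y'))) y
      = (partialDeriv a (partialDeriv b Φ) (y + proj (u y))) i := by
    intro a b
    have h1 : ∀ e, partialDeriv e (fun y' => G y' e b * partialDeriv a (fun x => Φ x i) (y' + proj (u y'))) y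
        = G y e b * partialDeriv e (fun y' => partialDeriv a (fun x => Φ x i) (y' + proj (u y'))) y
          + partialDeriv e (fun y' => G y' e b) y * partialDeriv a (fun x => Φ x i) (y + proj (u y)) :=
      fun e => partialDeriv_mul ((hG e b).isContDiff (by simp)) ((hψS i a).isContDiff (by simp)) e y
    simp_rw [h1]
    rw [Finset.sum_add_distrib, ← Finset.sum_mul, hPiola b y, zero_mul, add_zero,
      sum_mul_partialDeriv_comp_displacement ((hΦi i).partialDeriv a) hu (hJG y) b, partialDeriv_partialDeriv_apply hΦ a b _ i]
  calc ∑ c, ∑ e, partialDeriv e (fun y' => FluidPDE.Torus.Visc4.conj (G y') 𝔸 i c l e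
          * (partialDeriv c (fun x => Φ (x + proj (u x))) y') i) y
      = ∑ e, ∑ c, partialDeriv e (fun y' => FluidPDE.Torus.Visc4.conj (G y') 𝔸 i c l e
          * (partialDeriv c (fun x => Φ (x + proj (u x))) y') i) y := Finset.sum_comm
    _ = ∑ e, partialDeriv e (fun y' => ∑ c, FluidPDE.Torus.Visc4.conj (G y') 𝔸 i c l e
          * (partialDeriv c (fun x => Φ (x + proj (u x))) y') i) y :=
        Finset.sum_congr rfl fun e _ => (partialDeriv_finset_sum Finset.univ
          (fun c _ => (hg i c l e).isContDiff (by simp)) e y).symm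
    _ = ∑ e, partialDeriv e (fun y' => ∑ a, ∑ b, 𝔸 i a l b * (G y' e b * partialDeriv a (fun x => Φ x i) (y' + proj (u y')))) y :=
        Finset.sum_congr rfl fun e _ => by rw [hinner e]
    _ = ∑ e, ∑ a, ∑ b, 𝔸 i a l b * partialDeriv e (fun y' => G y' e b * partialDeriv a (fun x => Φ x i) (y' + proj (u y'))) y := by
        refine Finset.sum_congr rfl fun e _ => ?_
        have hab : ∀ a, IsSmooth (fun y' => ∑ b, 𝔸 i a l b * (G y' e b * partialDeriv a (fun x => Φ x i) (y' + proj (u y')))) :=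
          fun a => ContDiff.sum fun b _ => hAh i a l b e
        rw [partialDeriv_finset_sum Finset.univ (fun a _ => (hab a).isContDiff (by simp)) e y]
        refine Finset.sum_congr rfl fun a _ => ?_
        rw [partialDeriv_finset_sum Finset.univ (fun b _ => (hAh i a l b e).isContDiff (by simp)) e y]
        exact Finset.sum_congr rfl fun b _ => partialDeriv_const_mul' ((hh i a b e).isContDiff (by simp)) _ e y
    _ = ∑ a, ∑ b, 𝔸 i a l b * ∑ e, partialDeriv e (fun y' => G y' e b * partialDeriv a (fun x => Φ x i) (y' + proj (u y'))) y := by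
        rw [Finset.sum_comm]
        refine Finset.sum_congr rfl fun a _ => ?_
        rw [Finset.sum_comm]
        exact Finset.sum_congr rfl fun b _ => by rw [Finset.mul_sum]
    _ = ∑ a, ∑ b, 𝔸 i a l b * (partialDeriv a (partialDeriv b Φ) (y + proj (u y))) i :=
        Finset.sum_congr rfl fun a _ => Finset.sum_congr rfl fun b _ => by rw [hkey a b]

end Displacement

/-! ## §2 The Lagrangian frame of a level-regular carrier on a refresh window -/

section Frame

variable {k : ℕ}

/-- **THE VISCOUS CONJUGATION IDENTITY IN THE EXACT-FLOW FRAME** (memo L15 §1 (iv), item (C2)).  On a refresh window piece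
`[jR, jR+u]`, `u ∈ [0, T]`, `T < refresh (m+1)`, with `G = frameG E m (jR+u) (jR) = (∇X)⁻¹` and `X = E.X m (jR+u) (jR)`:
`viscAdjVar (fun y => 𝔸^{G(y)}) (Φ ∘ X) y = (viscAdj 𝔸 Φ)(X y)` for every constant tensor `𝔸` and smooth `Φ`.
(Armstrong–Vicol 2025 §4.1, the distortion `s_{m−1}` of `T_{m−1}`, PDF p. 34.) [folklore] -/
theorem viscAdjVar_conj_frameG (E : LagrangianLatticeCarrier k) (hR : E.LevelRegular) {m : ℕ} (hF : E.IsFlow m) (j : ℤ) {T : ℝ}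
    (hT : T < E.refresh (m + 1)) {u : ℝ} (hu : u ∈ Icc 0 T) (𝔸 : FluidPDE.Torus.Visc4 (Fin 3))
    {Φ : UnitAddTorus (Fin 3) → EuclideanSpace ℝ (Fin 3)} (hΦ : IsSmooth Φ) (y : UnitAddTorus (Fin 3)) :
    FluidPDE.Torus.viscAdjVar (fun y' => FluidPDE.Torus.Visc4.conj
        (frameG E m ((j : ℝ) * E.refresh (m + 1) + u) ((j : ℝ) * E.refresh (m + 1)) y') 𝔸)
      (fun x => Φ (E.X m ((j : ℝ) * E.refresh (m + 1) + u) ((j : ℝ) * E.refresh (m + 1)) x)) y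
      = FluidPDE.Torus.viscAdj 𝔸 Φ (E.X m ((j : ℝ) * E.refresh (m + 1) + u) ((j : ℝ) * E.refresh (m + 1)) y) := by
  have hD : IsSmooth (E.disp m ((j : ℝ) * E.refresh (m + 1) + u) ((j : ℝ) * E.refresh (m + 1))) := hR.isSmooth_disp m _ _
  have hG : ∀ e b, IsSmooth (fun y' => frameG E m ((j : ℝ) * E.refresh (m + 1) + u) ((j : ℝ) * E.refresh (m + 1)) y' e b) :=
    fun e b => isSmooth_frameG_entry E hR hF j hT hu e b
  have hJG : ∀ (y' : UnitAddTorus (Fin 3)) (a a' : Fin 3), ∑ c, ((ContinuousLinearMap.id ℝ (EuclideanSpace ℝ (Fin 3))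
      + Torus.fderiv (E.disp m ((j : ℝ) * E.refresh (m + 1) + u) ((j : ℝ) * E.refresh (m + 1))) y') (EuclideanSpace.single c 1)) a'
      * frameG E m ((j : ℝ) * E.refresh (m + 1) + u) ((j : ℝ) * E.refresh (m + 1)) y' c a = if a' = a then 1 else 0 := by
    intro y' a a'
    have hdet : IsUnit (frameJac E m ((j : ℝ) * E.refresh (m + 1) + u) ((j : ℝ) * E.refresh (m + 1)) y').det := by
      rw [det_frameJac_eq_one E hR hF j hT hu y']; exact isUnit_one
    have h := Matrix.mul_nonsing_inv _ hdet
    have h2 := congrFun (congrFun h a') a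
    rw [Matrix.mul_apply, Matrix.one_apply] at h2
    have hfd : E.flowDeriv m ((j : ℝ) * E.refresh (m + 1) + u) ((j : ℝ) * E.refresh (m + 1)) y'
        = ContinuousLinearMap.id ℝ (EuclideanSpace ℝ (Fin 3))
          + Torus.fderiv (E.disp m ((j : ℝ) * E.refresh (m + 1) + u) ((j : ℝ) * E.refresh (m + 1))) y' := by
      rw [LagrangianLatticeCarrier.flowDeriv, fderiv_lift, proj_repr]
    rw [← hfd]
    exact h2
  have hPiola : ∀ (b : Fin 3) (y' : UnitAddTorus (Fin 3)),
      ∑ e, partialDeriv e (fun y'' => frameG E m ((j : ℝ) * E.refresh (m + 1) + u) ((j : ℝ) * E.refresh (m + 1)) y'' e b) y' = 0 :=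
    fun b y' => by
      have h := isDivFree_frameG_col E hR hF j hT hu b y'
      simpa only [Torus.divergence, PiLp.toLp_apply] using h
  exact viscAdjVar_conj_comp_displacement 𝔸 hΦ hD hG hJG hPiola y

end Frame

end Summit.AnomalousDissipation.AnomalousDissipation.Theorems.SolenoidalFractalHomogenisation.LagrangianStep.FrameForm

end
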